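import Summits.RiemannHypothesis.RiemannHypothesis.Theorems.SoloInformedQuasiWeilSobolev

/-!
# Exponential slack in Weil's criterion, VII: width below a height, one derivative above it

Solo programme `solo-RiemannHypothesis-informed`, session 15 (T60, part 1 of 2; part 2 is
`SoloInformedQuasiWeilVK.lean`). Part VI (`zeroForm_re_ge_sobolev_of_width`) takes ONE width
`Θ` for all non-trivial zeros. Here the partial-sum step of part VI is proved for an arbitrary
finite set `T` of non-trivial zeros in two flavours:

* `sum_order_mul_norm_sq_le_of_width`: if every `ρ ∈ T` has `|Re ρ - 1/2| ≤ Θ/2` then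
  `Σ_{ρ ∈ T} m(ρ)(|ĝ(ρ)|² + |ĝ(1-ρ̄)|²) ≤ 4π d (1+Θa)(3+a²) e^{Θa} (‖g‖₂² + ‖g'‖₂²)`;
* `sum_order_mul_norm_sq_le_of_height`: if every `ρ ∈ T` has `|Im ρ| ≥ H` then, at the trivial
  width `1` but with the weights `m(ρ)/(1+γ²)²` (local count `≤ d/(1+H²)`),
  `Σ_{ρ ∈ T} m(ρ)(|ĝ(ρ)|² + |ĝ(1-ρ̄)|²) ≤ 4π (d/(1+H²)) (1+a)(3+a²) e^{a} (‖g‖₂²+2‖g'‖₂²+‖g''‖₂²)`.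

Part 2 splits the zeros at a height `H`, uses the first bound below and the second above, and
feeds in the tree's unconditional Vinogradov–Korobov region. Everything here is proved from
parts V–VI (`sum_mul_norm_sq_weilMellin_strip_le`, `one_add_im_sq_mul_norm_sq_weilMellin_le`);
no named facts.
-/

noncomputable section

open Complex Filter Set MeasureTheory
open scoped Real Topology ComplexConjugate

namespace Summit.RiemannHypothesis.RiemannHypothesis.Theorems

open Literature.NumberTheory.LFunctions Literature.NumberTheory.LFunctions.WeilConverse

variable {g : ℝ → ℂ}

/-- The point `1/2 + (Re ρ - 1/2) + i Im ρ` is `ρ`. [folklore] -/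
theorem half_add_offset_add_im_mul_I (ρ : ℂ) :
    (1 / 2 : ℂ) + ((ρ.re - 1 / 2 : ℝ) : ℂ) + (ρ.im : ℂ) * I = ρ := by
  apply Complex.ext <;> simp

/-- The point `1/2 - (Re ρ - 1/2) + i Im ρ` is the reflected zero `1 - ρ̄`. [folklore] -/
theorem half_add_neg_offset_add_im_mul_I (ρ : ℂ) :
    (1 / 2 : ℂ) + ((-(ρ.re - 1 / 2) : ℝ) : ℂ) + (ρ.im : ℂ) * I = 1 - conj ρ := by
  apply Complex.ext
  · simp; ring
  · simp

/-- **Width on a finite set suffices (first Sobolev level).** If every zero of a finite set `T`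
of non-trivial zeros has `|Re ρ - 1/2| ≤ Θ/2`, then for a test `g` on `[-a, a]`
`Σ_{ρ ∈ T} m(ρ)(|ĝ(ρ)|² + |ĝ(1-ρ̄)|²) ≤ 4π d (1+Θa)(3+a²) e^{Θa} (‖g‖₂² + ‖g'‖₂²)`, where `d`
bounds the local count of the weights `m(ρ)/(1+γ²)` — the partial-sum step of part VI with the
width hypothesis restricted to `T`. [folklore] -/
theorem sum_order_mul_norm_sq_le_of_width (hg : IsWeilTest g) {a : ℝ} (ha : 0 < a)
    (hsupp : tsupport g ⊆ Icc (-a) a) {d : ℝ}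
    (hd : ∀ (t : ℝ) (T : Finset ZetaZeros.riemannZetaNontrivialZeros),
      (∀ ρ ∈ T, |(ρ : ℂ).im - t| ≤ 1 / 2) →
        ∑ ρ ∈ T, (riemannZetaZeroOrder (ρ : ℂ) : ℝ) / (1 + (ρ : ℂ).im ^ 2) ≤ d)
    {Θ : ℝ} (hΘ : 0 < Θ) (T : Finset ZetaZeros.riemannZetaNontrivialZeros)
    (hT : ∀ ρ ∈ T, |(ρ : ℂ).re - 1 / 2| ≤ Θ / 2) :
    ∑ ρ ∈ T, (riemannZetaZeroOrder (ρ : ℂ) : ℝ) *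
        (‖weilMellin g ρ‖ ^ 2 + ‖weilMellin g (1 - conj (ρ : ℂ))‖ ^ 2) ≤
      4 * π * d * (1 + Θ * a) * (3 + a ^ 2) * Real.exp (Θ * a) *
        (weilNorm2Sq g + weilNorm2Sq (deriv g)) := by
  classical
  have hg' : IsWeilTest (deriv g) := hg.deriv
  have hsupp' : tsupport (deriv g) ⊆ Icc (-a) a := tsupport_deriv_subset.trans hsupp
  set m : ZetaZeros.riemannZetaNontrivialZeros → ℝ :=
    fun ρ ↦ (riemannZetaZeroOrder (ρ : ℂ) : ℝ) with hm
  have hm0 : ∀ ρ, 0 ≤ m ρ := fun ρ ↦ Int.cast_nonneg (by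
    have := ZetaZeros.riemannZetaNontrivialZeros.one_le_order ρ.2
    omega)
  set wt : ZetaZeros.riemannZetaNontrivialZeros → ℝ :=
    fun ρ ↦ m ρ / (1 + (ρ : ℂ).im ^ 2) with hwt
  have hwt0 : ∀ ρ, 0 ≤ wt ρ := fun ρ ↦ div_nonneg (hm0 ρ) (by positivity)
  have hmwt : ∀ ρ, m ρ = wt ρ * (1 + (ρ : ℂ).im ^ 2) := fun ρ ↦ by
    rw [hwt]; dsimp only; rw [div_mul_cancel₀ _ (by positivity)]
  have hloc : ∀ t : ℝ, ∑ ρ ∈ T.filter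
      (fun ρ : ZetaZeros.riemannZetaNontrivialZeros ↦ |(ρ : ℂ).im - t| ≤ 1 / 2), wt ρ ≤ d :=
    fun t ↦ hd t _ fun ρ hρ ↦ (Finset.mem_filter.1 hρ).2
  have hT' : ∀ ρ ∈ T, |(-((ρ : ℂ).re - 1 / 2))| ≤ Θ / 2 := fun ρ h ↦ by
    rw [abs_neg]; exact hT ρ h
  -- the strip sampling bound of part V, for `h ∈ {g, g'}` at the points `ρ` and `1 - ρ̄`
  have hS : ∀ {h : ℝ → ℂ}, IsWeilTest h → tsupport h ⊆ Icc (-a) a →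
      ∀ β : ZetaZeros.riemannZetaNontrivialZeros → ℝ, (∀ ρ ∈ T, |β ρ| ≤ Θ / 2) →
        ∑ ρ ∈ T, wt ρ * ‖weilMellin h (1 / 2 + (β ρ : ℂ) + ((ρ : ℂ).im : ℂ) * I)‖ ^ 2 ≤
          2 * π * d * (1 + Θ * a) * (3 + a ^ 2) * Real.exp (Θ * a) * weilNorm2Sq h :=
    fun hh hs β hβ ↦ sum_mul_norm_sq_weilMellin_strip_le T β
      (fun ρ : ZetaZeros.riemannZetaNontrivialZeros ↦ (ρ : ℂ).im) wt hwt0 hΘ hβ hloc hh ha hs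
  have hA := hS hg hsupp (fun ρ ↦ (ρ : ℂ).re - 1 / 2) hT
  have hA' := hS hg hsupp (fun ρ ↦ -((ρ : ℂ).re - 1 / 2)) hT'
  have hD := hS hg' hsupp' (fun ρ ↦ (ρ : ℂ).re - 1 / 2) hT
  have hD' := hS hg' hsupp' (fun ρ ↦ -((ρ : ℂ).re - 1 / 2)) hT'
  simp only [half_add_offset_add_im_mul_I, half_add_neg_offset_add_im_mul_I] at hA hA' hD hD'
  set B₀ : ℝ := 2 * π * d * (1 + Θ * a) * (3 + a ^ 2) * Real.exp (Θ * a) with hB₀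
  -- integration by parts: `m |ĝ(s)|² ≤ wt (|ĝ(s)|² + |(g')^(s)|²)` at `s = ρ, 1 - ρ̄`
  have hk : ∀ (ρ : ZetaZeros.riemannZetaNontrivialZeros) (s : ℂ), s.im = (ρ : ℂ).im →
      m ρ * ‖weilMellin g s‖ ^ 2 ≤
        wt ρ * ‖weilMellin g s‖ ^ 2 + wt ρ * ‖weilMellin (deriv g) s‖ ^ 2 := by
    intro ρ s hs
    have := one_add_im_sq_mul_norm_sq_weilMellin_le hg s
    rw [hs] at this
    rw [hmwt ρ, mul_assoc, ← mul_add]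
    exact mul_le_mul_of_nonneg_left this (hwt0 ρ)
  have h₁ : ∑ ρ ∈ T, m ρ * ‖weilMellin g ρ‖ ^ 2 ≤ ∑ ρ ∈ T, wt ρ * ‖weilMellin g ρ‖ ^ 2 +
      ∑ ρ ∈ T, wt ρ * ‖weilMellin (deriv g) ρ‖ ^ 2 := by
    rw [← Finset.sum_add_distrib]
    exact Finset.sum_le_sum fun ρ _ ↦ hk ρ _ rfl
  have h₂ : ∑ ρ ∈ T, m ρ * ‖weilMellin g (1 - conj (ρ : ℂ))‖ ^ 2 ≤
      ∑ ρ ∈ T, wt ρ * ‖weilMellin g (1 - conj (ρ : ℂ))‖ ^ 2 +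
        ∑ ρ ∈ T, wt ρ * ‖weilMellin (deriv g) (1 - conj (ρ : ℂ))‖ ^ 2 := by
    rw [← Finset.sum_add_distrib]
    exact Finset.sum_le_sum fun ρ _ ↦ hk ρ _ (WeilConverse.one_sub_conj_im _)
  calc ∑ ρ ∈ T, m ρ * (‖weilMellin g ρ‖ ^ 2 + ‖weilMellin g (1 - conj (ρ : ℂ))‖ ^ 2)
      = ∑ ρ ∈ T, m ρ * ‖weilMellin g ρ‖ ^ 2 +
          ∑ ρ ∈ T, m ρ * ‖weilMellin g (1 - conj (ρ : ℂ))‖ ^ 2 := by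
        rw [← Finset.sum_add_distrib]
        exact Finset.sum_congr rfl fun ρ _ ↦ mul_add _ _ _
    _ ≤ (B₀ * weilNorm2Sq g + B₀ * weilNorm2Sq (deriv g)) +
          (B₀ * weilNorm2Sq g + B₀ * weilNorm2Sq (deriv g)) := by linarith
    _ = 4 * π * d * (1 + Θ * a) * (3 + a ^ 2) * Real.exp (Θ * a) *
          (weilNorm2Sq g + weilNorm2Sq (deriv g)) := by rw [hB₀]; ring

/-- **Height instead of width (second Sobolev level).** If every zero of a finite set `T` of
non-trivial zeros has `|Im ρ| ≥ H ≥ 0`, then for a test `g` on `[-a, a]`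
`Σ_{ρ ∈ T} m(ρ)(|ĝ(ρ)|² + |ĝ(1-ρ̄)|²) ≤ 4π (d/(1+H²)) (1+a)(3+a²) e^{a} (‖g‖₂²+2‖g'‖₂²+‖g''‖₂²)`:
the trivial width `1` (`0 < Re ρ < 1`) is used, the weights `m(ρ)/(1+γ²)²` have local count
`≤ d/(1+H²)` on `T`, and `(1+γ²)² |ĝ(s)|² ≤ |ĝ(s)|² + 2|(g')^(s)|² + |(g'')^(s)|²`. [folklore] -/
theorem sum_order_mul_norm_sq_le_of_height (hg : IsWeilTest g) {a : ℝ} (ha : 0 < a)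
    (hsupp : tsupport g ⊆ Icc (-a) a) {d : ℝ}
    (hd : ∀ (t : ℝ) (T : Finset ZetaZeros.riemannZetaNontrivialZeros),
      (∀ ρ ∈ T, |(ρ : ℂ).im - t| ≤ 1 / 2) →
        ∑ ρ ∈ T, (riemannZetaZeroOrder (ρ : ℂ) : ℝ) / (1 + (ρ : ℂ).im ^ 2) ≤ d)
    {H : ℝ} (hH : 0 ≤ H) (T : Finset ZetaZeros.riemannZetaNontrivialZeros)
    (hT : ∀ ρ ∈ T, H ≤ |(ρ : ℂ).im|) :
    ∑ ρ ∈ T, (riemannZetaZeroOrder (ρ : ℂ) : ℝ) *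
        (‖weilMellin g ρ‖ ^ 2 + ‖weilMellin g (1 - conj (ρ : ℂ))‖ ^ 2) ≤
      4 * π * (d / (1 + H ^ 2)) * (1 + a) * (3 + a ^ 2) * Real.exp a *
        (weilNorm2Sq g + 2 * weilNorm2Sq (deriv g) + weilNorm2Sq (deriv (deriv g))) := by
  classical
  have hg' : IsWeilTest (deriv g) := hg.deriv
  have hg'' : IsWeilTest (deriv (deriv g)) := hg'.deriv
  have hsupp' : tsupport (deriv g) ⊆ Icc (-a) a := tsupport_deriv_subset.trans hsupp
  have hsupp'' : tsupport (deriv (deriv g)) ⊆ Icc (-a) a := tsupport_deriv_subset.trans hsupp'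
  set m : ZetaZeros.riemannZetaNontrivialZeros → ℝ :=
    fun ρ ↦ (riemannZetaZeroOrder (ρ : ℂ) : ℝ) with hm
  have hm0 : ∀ ρ, 0 ≤ m ρ := fun ρ ↦ Int.cast_nonneg (by
    have := ZetaZeros.riemannZetaNontrivialZeros.one_le_order ρ.2
    omega)
  -- every non-trivial zero has width `≤ 1`
  have hTw : ∀ ρ ∈ T, |(ρ : ℂ).re - 1 / 2| ≤ 1 / 2 := fun ρ _ ↦ abs_le.2
    ⟨by linarith [ZetaZeros.riemannZetaNontrivialZeros.re_pos ρ.2],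
     by linarith [ZetaZeros.riemannZetaNontrivialZeros.re_lt_one ρ.2]⟩
  have hTw' : ∀ ρ ∈ T, |(-((ρ : ℂ).re - 1 / 2))| ≤ 1 / 2 := fun ρ h ↦ by
    rw [abs_neg]; exact hTw ρ h
  set wt : ZetaZeros.riemannZetaNontrivialZeros → ℝ :=
    fun ρ ↦ m ρ / (1 + (ρ : ℂ).im ^ 2) with hwt
  set wt₂ : ZetaZeros.riemannZetaNontrivialZeros → ℝ :=
    fun ρ ↦ wt ρ / (1 + (ρ : ℂ).im ^ 2) with hwt₂
  have hwt0 : ∀ ρ, 0 ≤ wt ρ := fun ρ ↦ div_nonneg (hm0 ρ) (by positivity)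
  have hwt₂0 : ∀ ρ, 0 ≤ wt₂ ρ := fun ρ ↦ div_nonneg (hwt0 ρ) (by positivity)
  have hmwt₂ : ∀ ρ, m ρ = wt₂ ρ * (1 + (ρ : ℂ).im ^ 2) * (1 + (ρ : ℂ).im ^ 2) := fun ρ ↦ by
    rw [hwt₂, hwt]; dsimp only
    rw [div_mul_cancel₀ _ (by positivity), div_mul_cancel₀ _ (by positivity)]
  -- local count of the second-level weights on `T` (all heights `≥ H`)
  have hloc : ∀ t : ℝ, ∑ ρ ∈ T.filter
      (fun ρ : ZetaZeros.riemannZetaNontrivialZeros ↦ |(ρ : ℂ).im - t| ≤ 1 / 2), wt₂ ρ ≤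
        d / (1 + H ^ 2) := by
    intro t
    set F := T.filter
      (fun ρ : ZetaZeros.riemannZetaNontrivialZeros ↦ |(ρ : ℂ).im - t| ≤ 1 / 2) with hF
    have hFd : ∑ ρ ∈ F, wt ρ ≤ d := hd t F fun ρ hρ ↦ (Finset.mem_filter.1 hρ).2
    have hle : ∀ ρ ∈ F, wt₂ ρ ≤ wt ρ / (1 + H ^ 2) := by
      intro ρ hρ
      have hγ : H ^ 2 ≤ (ρ : ℂ).im ^ 2 := by
        rw [← sq_abs ((ρ : ℂ).im)]
        exact pow_le_pow_left₀ hH (hT ρ (Finset.mem_filter.1 hρ).1) 2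
      exact div_le_div_of_nonneg_left (hwt0 ρ) (by positivity) (by linarith)
    calc ∑ ρ ∈ F, wt₂ ρ ≤ ∑ ρ ∈ F, wt ρ / (1 + H ^ 2) := Finset.sum_le_sum hle
      _ = (∑ ρ ∈ F, wt ρ) / (1 + H ^ 2) := by rw [Finset.sum_div]
      _ ≤ d / (1 + H ^ 2) := div_le_div_of_nonneg_right hFd (by positivity)
  -- the strip sampling bound of part V at width `1`, for `h ∈ {g, g', g''}` at `ρ` and `1 - ρ̄`
  have hS : ∀ {h : ℝ → ℂ}, IsWeilTest h → tsupport h ⊆ Icc (-a) a →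
      ∀ β : ZetaZeros.riemannZetaNontrivialZeros → ℝ, (∀ ρ ∈ T, |β ρ| ≤ 1 / 2) →
        ∑ ρ ∈ T, wt₂ ρ * ‖weilMellin h (1 / 2 + (β ρ : ℂ) + ((ρ : ℂ).im : ℂ) * I)‖ ^ 2 ≤
          2 * π * (d / (1 + H ^ 2)) * (1 + 1 * a) * (3 + a ^ 2) * Real.exp (1 * a) *
            weilNorm2Sq h :=
    fun hh hs β hβ ↦ sum_mul_norm_sq_weilMellin_strip_le (Θ := 1) T β
      (fun ρ : ZetaZeros.riemannZetaNontrivialZeros ↦ (ρ : ℂ).im) wt₂ hwt₂0 one_pos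
      (by simpa using hβ) hloc hh ha hs
  have hA := hS hg hsupp (fun ρ ↦ (ρ : ℂ).re - 1 / 2) hTw
  have hA' := hS hg hsupp (fun ρ ↦ -((ρ : ℂ).re - 1 / 2)) hTw'
  have hD := hS hg' hsupp' (fun ρ ↦ (ρ : ℂ).re - 1 / 2) hTw
  have hD' := hS hg' hsupp' (fun ρ ↦ -((ρ : ℂ).re - 1 / 2)) hTw'
  have hG := hS hg'' hsupp'' (fun ρ ↦ (ρ : ℂ).re - 1 / 2) hTw
  have hG' := hS hg'' hsupp'' (fun ρ ↦ -((ρ : ℂ).re - 1 / 2)) hTw'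
  simp only [half_add_offset_add_im_mul_I, half_add_neg_offset_add_im_mul_I, one_mul]
    at hA hA' hD hD' hG hG'
  set B₁ : ℝ := 2 * π * (d / (1 + H ^ 2)) * (1 + a) * (3 + a ^ 2) * Real.exp a with hB₁
  -- `(1+γ²)² |ĝ(s)|² ≤ |ĝ(s)|² + 2|(g')^(s)|² + |(g'')^(s)|²` at `s = ρ` and `s = 1 - ρ̄`
  have hsq : ∀ (ρ : ZetaZeros.riemannZetaNontrivialZeros) (s : ℂ), s.im = (ρ : ℂ).im →
      m ρ * ‖weilMellin g s‖ ^ 2 ≤ wt₂ ρ * ‖weilMellin g s‖ ^ 2 +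
        2 * (wt₂ ρ * ‖weilMellin (deriv g) s‖ ^ 2) +
          wt₂ ρ * ‖weilMellin (deriv (deriv g)) s‖ ^ 2 := by
    intro ρ s hs
    have h1 := one_add_im_sq_mul_norm_sq_weilMellin_le hg s
    have h2 := one_add_im_sq_mul_norm_sq_weilMellin_le hg' s
    rw [hs] at h1 h2
    have hP : 0 ≤ 1 + (ρ : ℂ).im ^ 2 := by positivity
    have h3 : (1 + (ρ : ℂ).im ^ 2) * ((1 + (ρ : ℂ).im ^ 2) * ‖weilMellin g s‖ ^ 2) ≤
        ‖weilMellin g s‖ ^ 2 + 2 * ‖weilMellin (deriv g) s‖ ^ 2 +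
          ‖weilMellin (deriv (deriv g)) s‖ ^ 2 := by
      calc (1 + (ρ : ℂ).im ^ 2) * ((1 + (ρ : ℂ).im ^ 2) * ‖weilMellin g s‖ ^ 2)
          ≤ (1 + (ρ : ℂ).im ^ 2) * (‖weilMellin g s‖ ^ 2 + ‖weilMellin (deriv g) s‖ ^ 2) :=
            mul_le_mul_of_nonneg_left h1 hP
        _ = (1 + (ρ : ℂ).im ^ 2) * ‖weilMellin g s‖ ^ 2 +
              (1 + (ρ : ℂ).im ^ 2) * ‖weilMellin (deriv g) s‖ ^ 2 := mul_add _ _ _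
        _ ≤ (‖weilMellin g s‖ ^ 2 + ‖weilMellin (deriv g) s‖ ^ 2) +
              (‖weilMellin (deriv g) s‖ ^ 2 + ‖weilMellin (deriv (deriv g)) s‖ ^ 2) :=
            add_le_add h1 h2
        _ = _ := by ring
    calc m ρ * ‖weilMellin g s‖ ^ 2
        = wt₂ ρ * ((1 + (ρ : ℂ).im ^ 2) * ((1 + (ρ : ℂ).im ^ 2) * ‖weilMellin g s‖ ^ 2)) := by
          rw [hmwt₂ ρ]; ring
      _ ≤ wt₂ ρ * (‖weilMellin g s‖ ^ 2 + 2 * ‖weilMellin (deriv g) s‖ ^ 2 +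
            ‖weilMellin (deriv (deriv g)) s‖ ^ 2) := mul_le_mul_of_nonneg_left h3 (hwt₂0 ρ)
      _ = _ := by ring
  have h₁ : ∑ ρ ∈ T, m ρ * ‖weilMellin g ρ‖ ^ 2 ≤
      ∑ ρ ∈ T, wt₂ ρ * ‖weilMellin g ρ‖ ^ 2 +
        2 * ∑ ρ ∈ T, wt₂ ρ * ‖weilMellin (deriv g) ρ‖ ^ 2 +
          ∑ ρ ∈ T, wt₂ ρ * ‖weilMellin (deriv (deriv g)) ρ‖ ^ 2 := by
    rw [Finset.mul_sum, ← Finset.sum_add_distrib, ← Finset.sum_add_distrib]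
    exact Finset.sum_le_sum fun ρ _ ↦ hsq ρ _ rfl
  have h₂ : ∑ ρ ∈ T, m ρ * ‖weilMellin g (1 - conj (ρ : ℂ))‖ ^ 2 ≤
      ∑ ρ ∈ T, wt₂ ρ * ‖weilMellin g (1 - conj (ρ : ℂ))‖ ^ 2 +
        2 * ∑ ρ ∈ T, wt₂ ρ * ‖weilMellin (deriv g) (1 - conj (ρ : ℂ))‖ ^ 2 +
          ∑ ρ ∈ T, wt₂ ρ * ‖weilMellin (deriv (deriv g)) (1 - conj (ρ : ℂ))‖ ^ 2 := by
    rw [Finset.mul_sum, ← Finset.sum_add_distrib, ← Finset.sum_add_distrib]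
    exact Finset.sum_le_sum fun ρ _ ↦ hsq ρ _ (WeilConverse.one_sub_conj_im _)
  calc ∑ ρ ∈ T, m ρ * (‖weilMellin g ρ‖ ^ 2 + ‖weilMellin g (1 - conj (ρ : ℂ))‖ ^ 2)
      = ∑ ρ ∈ T, m ρ * ‖weilMellin g ρ‖ ^ 2 +
          ∑ ρ ∈ T, m ρ * ‖weilMellin g (1 - conj (ρ : ℂ))‖ ^ 2 := by
        rw [← Finset.sum_add_distrib]
        exact Finset.sum_congr rfl fun ρ _ ↦ mul_add _ _ _
    _ ≤ (B₁ * weilNorm2Sq g + 2 * (B₁ * weilNorm2Sq (deriv g)) +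
          B₁ * weilNorm2Sq (deriv (deriv g))) +
        (B₁ * weilNorm2Sq g + 2 * (B₁ * weilNorm2Sq (deriv g)) +
          B₁ * weilNorm2Sq (deriv (deriv g))) := by linarith
    _ = 4 * π * (d / (1 + H ^ 2)) * (1 + a) * (3 + a ^ 2) * Real.exp a *
          (weilNorm2Sq g + 2 * weilNorm2Sq (deriv g) + weilNorm2Sq (deriv (deriv g))) := by
        rw [hB₁]; ring

end Summit.RiemannHypothesis.RiemannHypothesis.Theorems
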